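import Summits.Ventures.CertifiedArithmetic.LowPrec.OptTreePolyFormats
import Summits.Ventures.CertifiedArithmetic.LowPrec.OptTreeSequential
import Literature.ComputerArithmetic.JeannerodRump2018.Theorem41

/-!
# The signed sandwich: a tree-polynomial UPPER bound for signed data (Jeannerod–Rump 4.1 by trees)

HONEST FRAMING (venture CertifiedArithmetic / cell `pub-lowprec`): certified error envelopes and
provably optimal rounding/accumulation schemes for low-precision formats under stated cost models;
every table by two implementations; no hardware or vendor claims.

OPTIMA.md Theorem T4 (`OptTreePoly`): nonnegative data under-estimate by at most `1 - 1/M_t(u)`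
(`M(leaf) = 1`, `M(node) = max + u·min`), sharp under ties-to-even.  The signed analogue with the
same constant (Conjecture S) is FALSE at every precision (`OptTreePolySignedRefutation`).  What IS
true for signed data, for every tree, every `n`, any tie rule, gradual underflow included:

  **`|ŝ - s| ≤ (M_t(v) - 1) · Σ|xᵢ|`,   `v = u/(1+u)`**

(`abs_eval_sub_exact_le_treeM_roundNearest`, abstract Jeannerod–Rump model `F(p, emin)`, any
round-to-nearest `fl`; `abs_eval_sub_exact_le_treeM_format` in every bit-level format of the
venture on in-range trees).  PROOF: induction with the invariant `|ŝ_a - s_a| ≤ (M_a - 1)·L_a`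
(`L` = leaf mass); at a node with `M_b ≤ M_a` the local error `δ` obeys BOTH `|δ| ≤ v(|ŝ_a|+|ŝ_b|)`
(relative error of one addition, [JeannerodRump2018, (4.1)]) and `|δ| ≤ |ŝ_b|` (`ŝ_a` is a
rounding candidate); use the second when `L_b ≤ v·L_a` and the first otherwise
(`node_step_signed`).  No restriction on `n`.

CONSEQUENCES.  (i) Since `M_t(v) ≤ 1 + (n-1)v` for every tree (`treeM_le_sequential`), this is a
tree-by-tree refinement of [JeannerodRump2018, Thm 4.1] (`(n-1)u/(1+u)`, any order), recovered as
`abs_eval_sub_exact_le_jr41_of_treeM`; for a node of two leaves it IS the optimal `u/(1+u)`.  (ii)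
Together with T4(b) the exact signed worst case `W_t` of every tree is SANDWICHED between two tree
polynomials, `1 - 1/M_t(u) ≤ W_t ≤ M_t(u/(1+u)) - 1`, both `= h_t·u + O(u²)` with `h_t` the height:
the tree polynomial governs signed summation to first order, and Conjecture S fails only at second
order (`τ₉`: `6u - 34u²` < `6u - 32.5u²` < `6u - 4u²`).  (iii) It does NOT dominate Lange–Rump's
restricted bounds (`(n-1)u/(1+(n-1)u)` any order, `h·u` by height, both for `n - 1 ≤ ½u⁻¹`): for
balanced trees of height `h ≥ 3`, `(1+v)^h - 1 > h·u`.  Placement: JR 4.1 and the height/depth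
bounds are KNOWN; the tree-polynomial form and the sandwich are this cell's (search: OPTIMA §T(f)).
-/

namespace Summit.Ventures.CertifiedArithmetic.LowPrec.Opt

open Literature.ComputerArithmetic.JeannerodRump2018
open Literature.ComputerArithmetic.JeannerodRump2018.SumTree
open Literature.ComputerArithmetic.FloatingPoint
open Literature.ComputerArithmetic.FloatingPoint.MiniFloat

/-! ## §1 The node step -/

/-- NODE STEP (oriented, `Mb ≤ Ma`): from `ea ≤ (Ma-1)La`, `eb ≤ (Mb-1)Lb`, `|ŝ_a| ≤ Ma·La`,
`|ŝ_b| ≤ Mb·Lb` and a local error `d ≤ |ŝ_b|`, `d ≤ v(|ŝ_a| + |ŝ_b|)`: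
`d + ea + eb ≤ (Ma + v·Mb - 1)(La + Lb)`. -/
theorem node_step_signed_oriented {v Ma Mb La Lb ea eb d A B : ℚ} (hv0 : 0 ≤ v)
    (hMb : 1 ≤ Mb) (hba : Mb ≤ Ma) (_hLa : 0 ≤ La) (hLb : 0 ≤ Lb)
    (hea : ea ≤ (Ma - 1) * La) (heb : eb ≤ (Mb - 1) * Lb) (hA : A ≤ Ma * La) (hB : B ≤ Mb * Lb)
    (hdB : d ≤ B) (hdv : d ≤ v * (A + B)) :
    d + ea + eb ≤ (Ma + v * Mb - 1) * (La + Lb) := by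
  have hMb0 : 0 ≤ Mb := by linarith
  rcases le_total Lb (v * La) with hcase | hcase
  · -- light right mass: the local error is at most |ŝ_b| ≤ Mb·Lb ≤ v·Mb·La
    have h1 : d ≤ Mb * (v * La) := le_trans hdB (le_trans hB (mul_le_mul_of_nonneg_left hcase hMb0))
    nlinarith [mul_nonneg (sub_nonneg.2 hba) hLb, mul_nonneg (mul_nonneg hv0 hMb0) hLb]
  · -- heavy right mass: the relative bound, and (Ma - Mb)(Lb - v·La) ≥ 0
    have h1 : d ≤ v * (Ma * La + Mb * Lb) := le_trans hdv (by nlinarith)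
    nlinarith [mul_nonneg (sub_nonneg.2 hba) (sub_nonneg.2 hcase)]

/-- NODE STEP, symmetric form (`M(node) = max + v·min`). -/
theorem node_step_signed {v Ma Mb La Lb ea eb d A B : ℚ} (hv0 : 0 ≤ v)
    (hMa : 1 ≤ Ma) (hMb : 1 ≤ Mb) (hLa : 0 ≤ La) (hLb : 0 ≤ Lb)
    (hea : ea ≤ (Ma - 1) * La) (heb : eb ≤ (Mb - 1) * Lb) (hA : A ≤ Ma * La) (hB : B ≤ Mb * Lb)
    (hdA : d ≤ A) (hdB : d ≤ B) (hdv : d ≤ v * (A + B)) :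
    d + ea + eb ≤ (max Ma Mb + v * min Ma Mb - 1) * (La + Lb) := by
  rcases le_total Mb Ma with h | h
  · rw [max_eq_left h, min_eq_right h]
    exact node_step_signed_oriented hv0 hMb h hLa hLb hea heb hA hB hdB hdv
  · rw [max_eq_right h, min_eq_left h]
    have := node_step_signed_oriented hv0 hMa h hLb hLa heb hea hB hA hdA
      (by rw [add_comm]; exact hdv)
    linarith

/-! ## §2 The tree theorem (abstract round-to-nearest) -/

/-- **SIGNED TREE-POLYNOMIAL UPPER BOUND (abstract).** `P` = "representable"; `fl` maps into `P`,
never errs by more than the second operand (`h1`: the first operand is a rounding candidate) and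
has relative error `v` in the weak form `|fl(a+b) - (a+b)| ≤ v(|a| + |b|)` (`h2`).  Then for
representable (SIGNED) summands and every tree: `|ŝ - s| ≤ (M_t(v) - 1)·Σ|xᵢ|`, and
`|ŝ| ≤ M_t(v)·Σ|xᵢ|`. -/
theorem abs_eval_sub_exact_le_treeM_sub_one {v : ℚ} (hv0 : 0 ≤ v) (P : ℚ → Prop) (fl : ℚ → ℚ)
    (hP : ∀ t, P (fl t))
    (h1 : ∀ a b, P a → P b → |fl (a + b) - (a + b)| ≤ |b|)
    (h2 : ∀ a b, P a → P b → |fl (a + b) - (a + b)| ≤ v * (|a| + |b|)) :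
    ∀ t : SumTree, (∀ x ∈ leaves t, P x) →
      |eval fl t - exact t| ≤ (treeM v t - 1) * absSum t ∧ P (eval fl t) ∧
        |eval fl t| ≤ treeM v t * absSum t
  | .leaf x, hl => by
      have hx : P x := hl x (by simp [leaves])
      simp [eval, exact, absSum, leaves, hx]
  | .node l r, hl => by
      obtain ⟨el, hPl, hAl⟩ := abs_eval_sub_exact_le_treeM_sub_one hv0 P fl hP h1 h2 l
        (fun x hx => hl x (by simp [leaves, hx]))
      obtain ⟨er, hPr, hAr⟩ := abs_eval_sub_exact_le_treeM_sub_one hv0 P fl hP h1 h2 r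
        (fun x hx => hl x (by simp [leaves, hx]))
      have hMl := one_le_treeM hv0 l
      have hMr := one_le_treeM hv0 r
      have hLl := absSum_nonneg l
      have hLr := absSum_nonneg r
      have hd1 : |fl (eval fl l + eval fl r) - (eval fl l + eval fl r)| ≤ |eval fl r| :=
        h1 _ _ hPl hPr
      have hd1' : |fl (eval fl l + eval fl r) - (eval fl l + eval fl r)| ≤ |eval fl l| := by
        have := h1 _ _ hPr hPl; rwa [add_comm (eval fl r)] at this
      have hd2 := h2 _ _ hPl hPr
      have step := node_step_signed hv0 hMl hMr hLl hLr el er hAl hAr hd1' hd1 hd2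
      have htri : |fl (eval fl l + eval fl r) - (exact l + exact r)|
          ≤ |fl (eval fl l + eval fl r) - (eval fl l + eval fl r)|
            + |eval fl l - exact l| + |eval fl r - exact r| := by
        rw [show fl (eval fl l + eval fl r) - (exact l + exact r)
            = (fl (eval fl l + eval fl r) - (eval fl l + eval fl r))
              + (eval fl l - exact l) + (eval fl r - exact r) by ring]
        exact abs_add_three _ _ _
      have hex : |exact l + exact r| ≤ absSum l + absSum r :=
        le_trans (abs_add_le _ _) (add_le_add (abs_exact_le_absSum l) (abs_exact_le_absSum r))
      refine ⟨?_, hP _, ?_⟩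
      · rw [absSum_node, treeM_node]
        simp only [eval, exact]
        exact le_trans htri step
      · rw [absSum_node, treeM_node]
        simp only [eval]
        have hM1 : 1 ≤ max (treeM v l) (treeM v r) + v * min (treeM v l) (treeM v r) := by
          have : 0 ≤ v * min (treeM v l) (treeM v r) :=
            mul_nonneg hv0 (le_min (by linarith) (by linarith))
          linarith [le_max_left (treeM v l) (treeM v r)]
        calc |fl (eval fl l + eval fl r)|
            ≤ |fl (eval fl l + eval fl r) - (exact l + exact r)| + |exact l + exact r| := by
              have := abs_add_le (fl (eval fl l + eval fl r) - (exact l + exact r))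
                (exact l + exact r)
              rwa [sub_add_cancel] at this
          _ ≤ (max (treeM v l) (treeM v r) + v * min (treeM v l) (treeM v r) - 1)
                * (absSum l + absSum r) + (absSum l + absSum r) :=
              add_le_add (le_trans htri step) hex
          _ = (max (treeM v l) (treeM v r) + v * min (treeM v l) (treeM v r))
                * (absSum l + absSum r) := by ring

/-- **SIGNED TREE-POLYNOMIAL UPPER BOUND in the Jeannerod–Rump model**: for any round-to-nearest
`fl` into `F(p, emin)` (any tie rule, gradual underflow, no overflow), floating-point summands of
ANY signs and EVERY summation tree, with `v = u/(1+u)`: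
`|ŝ - s| ≤ (M_t(v) - 1) · Σ|xᵢ|` — no restriction on `n`. [cite: JeannerodRump2018, Thm 4.1] -/
theorem abs_eval_sub_exact_le_treeM_roundNearest {p : ℕ} {emin : ℤ} {fl : ℚ → ℚ} (hp : 1 ≤ p)
    (hfl : IsRoundNearest p emin fl) (t : SumTree) (ht : ∀ x ∈ leaves t, IsFloat p emin x) :
    |eval fl t - exact t|
      ≤ (treeM (unitRoundoff p / (1 + unitRoundoff p)) t - 1) * absSum t := by
  have hu : 0 ≤ unitRoundoff p := unitRoundoff_nonneg p
  refine (abs_eval_sub_exact_le_treeM_sub_one (div_nonneg hu (by linarith)) (IsFloat p emin) fl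
    (fun s => (hfl s).1) (fun a b ha _ => abs_err_le_abs_operand hfl ha b)
    (fun a b ha hb => le_trans (abs_err_add_le_sharp hp hfl ha hb)
      (mul_le_mul_of_nonneg_left (abs_add_le a b) (div_nonneg hu (by linarith)))) t ht).1

/-- JEANNEROD–RUMP 4.1 RECOVERED, tree by tree: `M_t(v) - 1 ≤ (n-1)·v`, so the bound above implies
`|ŝ - s| ≤ (n-1)·u/(1+u)·Σ|xᵢ|` for every tree. [cite: JeannerodRump2018, Thm 4.1] -/
theorem abs_eval_sub_exact_le_jr41_of_treeM {p : ℕ} {emin : ℤ} {fl : ℚ → ℚ} (hp : 1 ≤ p)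
    (hfl : IsRoundNearest p emin fl) (t : SumTree) (ht : ∀ x ∈ leaves t, IsFloat p emin x) :
    |eval fl t - exact t|
      ≤ (((leaves t).length : ℚ) - 1) * (unitRoundoff p / (1 + unitRoundoff p)) * absSum t := by
  have hu : 0 ≤ unitRoundoff p := unitRoundoff_nonneg p
  have hv0 : 0 ≤ unitRoundoff p / (1 + unitRoundoff p) := div_nonneg hu (by linarith)
  have hv1 : unitRoundoff p / (1 + unitRoundoff p) ≤ 1 := by
    rw [div_le_one (by linarith)]; linarith
  refine le_trans (abs_eval_sub_exact_le_treeM_roundNearest hp hfl t ht)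
    (mul_le_mul_of_nonneg_right ?_ (absSum_nonneg t))
  linarith [treeM_le_sequential hv0 hv1 t]

/-! ## §3 In the bit-level formats -/

/-- **SIGNED TREE-POLYNOMIAL UPPER BOUND IN FORMAT `α`** (`m ≥ 1`; E4M3, E5M2, FP6/FP4, fp16, bf16,
fp32, P3109, …): for an evaluation tree whose leaves are values of `α` of ANY signs and whose every
node stays in range, `|ŝ - s| ≤ (M_t(u_α/(1+u_α)) - 1) · Σ|xᵢ|`, every tree, every `n`. -/
theorem abs_eval_sub_exact_le_treeM_format (α : Format) (hm : 1 ≤ α.manBits) (t : SumTree)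
    (ht : TreeInRange α t) :
    |eval (flα α) t - exact t|
      ≤ (treeM (α.unitRoundoff / (1 + α.unitRoundoff)) t - 1) * absSum t := by
  rw [eval_flα_eq_eval_flJR t ht, ← unitRoundoff_succ_manBits]
  exact abs_eval_sub_exact_le_treeM_roundNearest (by omega) (Format.isRoundNearest_flJR α) t
    (isFloat_of_mem_leaves t ht)

/-- THE SIGNED SANDWICH for the refuting tree `τ₉` (`M = 1 + 6u + 2u²`), numerically in E4M3
(`u = 1/16`, `v = 1/17`): lower tree polynomial `1 - 1/M(u) = 49/177 = 0.2768`, the kernel-checked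
signed value `153/551 = 0.2777` of `OptTreePolySignedRefutation.e4m3_signed_dp_witness`, and the
upper tree polynomial `M(v) - 1 = 6v + 2v² = 104/289 = 0.3599`. -/
theorem signed_sandwich_tau9_E4M3 :
    (1 - 1 / (1 + 6 * (1 / 16 : ℚ) + 2 * (1 / 16) ^ 2) : ℚ) = 49 / 177 ∧
    (1 + 6 * (1 / 17 : ℚ) + 2 * (1 / 17) ^ 2 - 1 : ℚ) = 104 / 289 ∧
    (49 / 177 : ℚ) < 153 / 551 ∧ (153 / 551 : ℚ) < 104 / 289 := by
  norm_num

end Summit.Ventures.CertifiedArithmetic.LowPrec.Opt
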